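import Literature.Computability.AlgebraicComplexity.LaserMethodBigCW
import Literature.Computability.AlgebraicComplexity.MaxEntropyGivenMarginals
import Literature.Computability.AlgebraicComplexity.LaserMethodTypeCount
import Literature.Computability.AlgebraicComplexity.LaserComponentTools
import Literature.Computability.AlgebraicComplexity.CwLaserBlocks
import Literature.Computability.AlgebraicComplexity.CoppersmithWinograd1990Proofs
import Literature.Computability.AlgebraicComplexity.RectangularExponentLaserCertificate
import Literature.Computability.AlgebraicComplexity.RectangularExponentAsymptoticRank
import Literature.Computability.AlgebraicComplexity.RectangularExponentSymmetry
import Literature.Computability.AlgebraicComplexity.RectangularExponentBounds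
import Literature.Computability.AlgebraicComplexity.RectangularExponentInformationBound
import Literature.Computability.AlgebraicComplexity.SchonhageRectangular
import HarnessLib
import Summits.MatrixMultiplication.MatrixMultiplication.Theorems.ShapeSubmodularityPerfectAmortisationStubCwRectRestriction

/-!
# Route `FarEdgeDescent` — little-CW far-edge bound, chain file 1/3: DATA and LAYER A (route-free helper)

Level/format data of the LITTLE Coppersmith–Winograd tensor `cw_q = Σᵢ (x₀yᵢzᵢ + xᵢy₀zᵢ + xᵢyᵢz₀)` (levels
`0 ↦ 0`, `1..q ↦ 1` inside `Fin 3`; block formats the tree's `cwFmtK/M/N`, i.e. `⟨q,1,1⟩, ⟨1,q,1⟩, ⟨1,1,q⟩` on the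
patterns `(1,1,0), (0,1,1), (1,0,1)`), the component identification `cwTensor_component`, and **Layer A**: for a free
diagonal `Δ` of level triples with constant pattern counts, `cw_q^{⊗N}` restricts to `⟨|Δ|⟩ ⊗ ⟨q^{m₁}, q^{m₂}, q^{m₃}⟩`
(BCS 1997 Prop. 15.30 / proof of Thm. 15.41), via the tree's generic
`tensorRestrictsTo_kroneckerPow_matMulDirectSum_of_free` and the LANDED equal-format / format-product lemmas of
`Theorems.ShapeSubmodularityPerfectAmortisationStubCwRectRestriction` (imported, not restated — gate dedup.landed).
This helper module imports NO `Theses` file (lint theses-cone); it is chain file 1 of 3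
(`LittleCwFarEdgeBoundData` → `LittleCwFarEdgeBoundLayers` → `LittleCwFarEdgeBound`), re-cut from the single
821-line draft `LittleCwFarEdgeBoundCore.lean` @c5d387b1 at the writer's request (STATUS 2026-08-30T06:13:20Z: Theorems
files ≤ 400 lines).  Written by the decomp-mm lens-2 planner seat (gen 6); imports only BUILT modules.
-/

set_option linter.dupNamespace false

noncomputable section

open Finset
open scoped BigOperators

namespace Summit.MatrixMultiplication.MatrixMultiplication.Theorems.LittleCwFarEdgeBound

open Literature.Computability.AlgebraicComplexity

/-! ## Level and format data of `cw_q` (levels `0 ↦ 0`, `1..q ↦ 1` inside `Fin 3`; formats = the tree's `cwFmtK/M/N`) -/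

section Data

variable {q : ℕ}

/-- The level of an index of `cw_q`: `x₀ ↦ 0`, `xᵢ ↦ 1` (`i ≥ 1`), as an element of `Fin 3`. -/
def lcwLevel (a : Fin (q + 1)) : Fin 3 := if a = 0 then 0 else 1

variable (q)

/-- The index of `cw_q` of level `l` and digit `d`: level `0 ↦ x₀`, otherwise `x_{d+1}` (clamped). -/
def lcwIdx (l : Fin 3) (d : ℕ) : Fin (q + 1) := if l = 0 then 0 else ⟨min (d + 1) q, by omega⟩

/-- The support of `cw_q` with respect to the levels: `{(0,1,1), (1,0,1), (1,1,0)}`. -/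
def lcwSupport₃ : Finset (Fin 3 × Fin 3 × Fin 3) :=
  {((0 : Fin 3), (1 : Fin 3), (1 : Fin 3)), ((1 : Fin 3), (0 : Fin 3), (1 : Fin 3)),
    ((1 : Fin 3), (1 : Fin 3), (0 : Fin 3))}

/-- Index maps of the components (digit `κ' + ν'` etc., as for `CW_q`). -/
def lcwEI (s : Fin 3 × Fin 3 × Fin 3) (u : Fin (cwFmtK q s) × Fin (cwFmtN q s)) : Fin (q + 1) :=
  lcwIdx q s.1 (u.1 + u.2)

/-- See `lcwEI`. -/
def lcwEJ (s : Fin 3 × Fin 3 × Fin 3) (v : Fin (cwFmtK q s) × Fin (cwFmtM q s)) : Fin (q + 1) :=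
  lcwIdx q s.2.1 (v.1 + v.2)

/-- See `lcwEI`. -/
def lcwEL (s : Fin 3 × Fin 3 × Fin 3) (w : Fin (cwFmtM q s) × Fin (cwFmtN q s)) : Fin (q + 1) :=
  lcwIdx q s.2.2 (w.1 + w.2)

variable {q}

/-- Membership in the support `lcwSupport₃` of the little `cw_q` block tensor: the level triples summing to `2`. -/
theorem mem_lcwSupport₃_iff {s : Fin 3 × Fin 3 × Fin 3} :
    s ∈ lcwSupport₃ ↔ s = (0, 1, 1) ∨ s = (1, 0, 1) ∨ s = (1, 1, 0) := by
  simp [lcwSupport₃]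

/-- The little support lies in the big one `{i + j + l = 2}`. -/
theorem lcwSupport₃_sum {s : Fin 3 × Fin 3 × Fin 3} (hs : s ∈ lcwSupport₃) :
    (s.1 : ℕ) + s.2.1 + s.2.2 = 2 := by
  rw [mem_lcwSupport₃_iff] at hs
  rcases hs with rfl | rfl | rfl <;> decide

/-- At level `0` the index map of `cw_q` is the constant `0`. -/
@[simp] theorem lcwIdx_zero (d : ℕ) : lcwIdx q 0 d = 0 := by simp [lcwIdx]

/-- At level `1` the index map of `cw_q` sends `d < q` to `d.succ`. -/
theorem lcwIdx_one {d : ℕ} (hd : d < q) : lcwIdx q 1 d = (⟨d, hd⟩ : Fin q).succ := by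
  unfold lcwIdx
  rw [if_neg (by decide), Fin.ext_iff]
  simp only [Fin.val_succ]
  omega

/-- The index `0` of `cw_q` has level `0`. -/
@[simp] theorem lcwLevel_zero : lcwLevel (0 : Fin (q + 1)) = 0 := by simp [lcwLevel]

/-- Every successor index of `cw_q` has level `1`. -/
@[simp] theorem lcwLevel_succ (x : Fin q) : lcwLevel x.succ = 1 := by
  simp [lcwLevel, Fin.succ_ne_zero]

/-- Every non-zero index of `cw_q` has level `1`. -/
theorem lcwLevel_of_ne_zero {a : Fin (q + 1)} (h : a ≠ 0) : lcwLevel a = 1 := by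
  simp [lcwLevel, h]

/-- **The support of `cw_q` lies in `{(0,1,1),(1,0,1),(1,1,0)}`** (`cwTensor_ne_zero_pattern`). -/
theorem lcwLevel_mem_support (K : Type*) [CommSemiring K] {a b c : Fin (q + 1)}
    (h : cwTensor K q a b c ≠ 0) : (lcwLevel a, lcwLevel b, lcwLevel c) ∈ lcwSupport₃ := by
  rw [mem_lcwSupport₃_iff]
  rcases cwTensor_ne_zero_pattern K q h with ⟨h1, h2, h3⟩ | ⟨h1, h2, h3⟩ | ⟨h1, h2, h3⟩
  · left; rw [h1, lcwLevel_zero, lcwLevel_of_ne_zero h2, lcwLevel_of_ne_zero h3]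
  · right; left; rw [h1, lcwLevel_zero, lcwLevel_of_ne_zero h2, lcwLevel_of_ne_zero h3]
  · right; right; rw [h1, lcwLevel_zero, lcwLevel_of_ne_zero h2, lcwLevel_of_ne_zero h3]

/-- The index maps stay inside their level blocks. -/
theorem lcwLevel_indexMaps (q : ℕ) :
    ∀ s ∈ lcwSupport₃,
      (∀ u : Fin (cwFmtK q s) × Fin (cwFmtN q s), lcwLevel (lcwEI q s u) = s.1) ∧
      (∀ v : Fin (cwFmtK q s) × Fin (cwFmtM q s), lcwLevel (lcwEJ q s v) = s.2.1) ∧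
      (∀ w : Fin (cwFmtM q s) × Fin (cwFmtN q s), lcwLevel (lcwEL q s w) = s.2.2) := by
  intro s hs
  rw [mem_lcwSupport₃_iff] at hs
  rcases hs with rfl | rfl | rfl
  · have hk : cwFmtK q ((0 : Fin 3), (1 : Fin 3), (1 : Fin 3)) = 1 := by simp [cwFmtK]
    have hm : cwFmtM q ((0 : Fin 3), (1 : Fin 3), (1 : Fin 3)) = q := by simp [cwFmtM]
    have hn : cwFmtN q ((0 : Fin 3), (1 : Fin 3), (1 : Fin 3)) = 1 := by simp [cwFmtN]
    refine ⟨fun u => by simp [lcwEI], fun v => ?_, fun w => ?_⟩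
    · have h1 := v.1.isLt; have h2 := v.2.isLt
      have hd : (v.1 : ℕ) + v.2 < q := by omega
      show lcwLevel (lcwIdx q 1 _) = 1
      rw [lcwIdx_one hd, lcwLevel_succ]
    · have h1 := w.1.isLt; have h2 := w.2.isLt
      have hd : (w.1 : ℕ) + w.2 < q := by omega
      show lcwLevel (lcwIdx q 1 _) = 1
      rw [lcwIdx_one hd, lcwLevel_succ]
  · have hk : cwFmtK q ((1 : Fin 3), (0 : Fin 3), (1 : Fin 3)) = 1 := by simp [cwFmtK]
    have hm : cwFmtM q ((1 : Fin 3), (0 : Fin 3), (1 : Fin 3)) = 1 := by simp [cwFmtM]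
    have hn : cwFmtN q ((1 : Fin 3), (0 : Fin 3), (1 : Fin 3)) = q := by simp [cwFmtN]
    refine ⟨fun u => ?_, fun v => by simp [lcwEJ], fun w => ?_⟩
    · have h1 := u.1.isLt; have h2 := u.2.isLt
      have hd : (u.1 : ℕ) + u.2 < q := by omega
      show lcwLevel (lcwIdx q 1 _) = 1
      rw [lcwIdx_one hd, lcwLevel_succ]
    · have h1 := w.1.isLt; have h2 := w.2.isLt
      have hd : (w.1 : ℕ) + w.2 < q := by omega
      show lcwLevel (lcwIdx q 1 _) = 1
      rw [lcwIdx_one hd, lcwLevel_succ]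
  · have hk : cwFmtK q ((1 : Fin 3), (1 : Fin 3), (0 : Fin 3)) = q := by simp [cwFmtK]
    have hm : cwFmtM q ((1 : Fin 3), (1 : Fin 3), (0 : Fin 3)) = 1 := by simp [cwFmtM]
    have hn : cwFmtN q ((1 : Fin 3), (1 : Fin 3), (0 : Fin 3)) = 1 := by simp [cwFmtN]
    refine ⟨fun u => ?_, fun v => ?_, fun w => by simp [lcwEL]⟩
    · have h1 := u.1.isLt; have h2 := u.2.isLt
      have hd : (u.1 : ℕ) + u.2 < q := by omega
      show lcwLevel (lcwIdx q 1 _) = 1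
      rw [lcwIdx_one hd, lcwLevel_succ]
    · have h1 := v.1.isLt; have h2 := v.2.isLt
      have hd : (v.1 : ℕ) + v.2 < q := by omega
      show lcwLevel (lcwIdx q 1 _) = 1
      rw [lcwIdx_one hd, lcwLevel_succ]

/-- **The components of `cw_q` are the matrix tensors `⟨cwFmtK, cwFmtM, cwFmtN⟩`** along the index maps
(`t(0,1,1) ≃ ⟨1,1,q⟩`, `t(1,0,1) ≃ ⟨q,1,1⟩`, `t(1,1,0) ≃ ⟨1,q,1⟩`, BCS p. 383). -/
theorem cwTensor_component (K : Type*) [CommSemiring K] (q : ℕ) (s : Fin 3 × Fin 3 × Fin 3)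
    (hs : s ∈ lcwSupport₃)
    (u : Fin (cwFmtK q s) × Fin (cwFmtN q s)) (v : Fin (cwFmtK q s) × Fin (cwFmtM q s))
    (w : Fin (cwFmtM q s) × Fin (cwFmtN q s)) :
    cwTensor K q (lcwEI q s u) (lcwEJ q s v) (lcwEL q s w) =
      matMulTensor K (cwFmtK q s) (cwFmtM q s) (cwFmtN q s) u v w := by
  rw [mem_lcwSupport₃_iff] at hs
  rcases hs with rfl | rfl | rfl
  · -- `(0,1,1)`: `k = n = 1`, `m = q`; entry `[v.2 = w.1]`
    have hk : cwFmtK q ((0 : Fin 3), (1 : Fin 3), (1 : Fin 3)) = 1 := by simp [cwFmtK]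
    have hm : cwFmtM q ((0 : Fin 3), (1 : Fin 3), (1 : Fin 3)) = q := by simp [cwFmtM]
    have hn : cwFmtN q ((0 : Fin 3), (1 : Fin 3), (1 : Fin 3)) = 1 := by simp [cwFmtN]
    have hu1 : (u.1 : ℕ) = 0 := by have := u.1.isLt; omega
    have hu2 : (u.2 : ℕ) = 0 := by have := u.2.isLt; omega
    have hv1 : (v.1 : ℕ) = 0 := by have := v.1.isLt; omega
    have hw2 : (w.2 : ℕ) = 0 := by have := w.2.isLt; omega
    have hdv : (v.1 : ℕ) + v.2 < q := by have := v.2.isLt; omega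
    have hdw : (w.1 : ℕ) + w.2 < q := by have := w.1.isLt; omega
    show cwTensor K q (lcwIdx q 0 _) (lcwIdx q 1 _) (lcwIdx q 1 _) = _
    rw [lcwIdx_zero, lcwIdx_one hdv, lcwIdx_one hdw, cwTensor_zero_succ_succ]
    simp only [matMulTensor, Fin.ext_iff, hu1, hv1, hu2, hw2, add_zero, zero_add, true_and, and_true]
  · -- `(1,0,1)`: `k = m = 1`, `n = q`; entry `[u.2 = w.2]`
    have hk : cwFmtK q ((1 : Fin 3), (0 : Fin 3), (1 : Fin 3)) = 1 := by simp [cwFmtK]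
    have hm : cwFmtM q ((1 : Fin 3), (0 : Fin 3), (1 : Fin 3)) = 1 := by simp [cwFmtM]
    have hn : cwFmtN q ((1 : Fin 3), (0 : Fin 3), (1 : Fin 3)) = q := by simp [cwFmtN]
    have hu1 : (u.1 : ℕ) = 0 := by have := u.1.isLt; omega
    have hv1 : (v.1 : ℕ) = 0 := by have := v.1.isLt; omega
    have hv2 : (v.2 : ℕ) = 0 := by have := v.2.isLt; omega
    have hw1 : (w.1 : ℕ) = 0 := by have := w.1.isLt; omega
    have hdu : (u.1 : ℕ) + u.2 < q := by have := u.2.isLt; omega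
    have hdw : (w.1 : ℕ) + w.2 < q := by have := w.2.isLt; omega
    show cwTensor K q (lcwIdx q 1 _) (lcwIdx q 0 _) (lcwIdx q 1 _) = _
    rw [lcwIdx_zero, lcwIdx_one hdu, lcwIdx_one hdw, cwTensor_succ_zero_succ]
    simp only [matMulTensor, Fin.ext_iff, hu1, hv1, hv2, hw1, zero_add, true_and]
  · -- `(1,1,0)`: `m = n = 1`, `k = q`; entry `[u.1 = v.1]`
    have hk : cwFmtK q ((1 : Fin 3), (1 : Fin 3), (0 : Fin 3)) = q := by simp [cwFmtK]
    have hm : cwFmtM q ((1 : Fin 3), (1 : Fin 3), (0 : Fin 3)) = 1 := by simp [cwFmtM]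
    have hn : cwFmtN q ((1 : Fin 3), (1 : Fin 3), (0 : Fin 3)) = 1 := by simp [cwFmtN]
    have hu2 : (u.2 : ℕ) = 0 := by have := u.2.isLt; omega
    have hv2 : (v.2 : ℕ) = 0 := by have := v.2.isLt; omega
    have hw1 : (w.1 : ℕ) = 0 := by have := w.1.isLt; omega
    have hw2 : (w.2 : ℕ) = 0 := by have := w.2.isLt; omega
    have hdu : (u.1 : ℕ) + u.2 < q := by have := u.1.isLt; omega
    have hdv : (v.1 : ℕ) + v.2 < q := by have := v.1.isLt; omega
    show cwTensor K q (lcwIdx q 1 _) (lcwIdx q 1 _) (lcwIdx q 0 _) = _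
    rw [lcwIdx_zero, lcwIdx_one hdu, lcwIdx_one hdv, cwTensor_succ_succ_zero]
    simp only [matMulTensor, Fin.ext_iff, hu2, hv2, hw1, hw2, add_zero, and_true]

end Data

/-! ## Layer A — tensor restriction along a free diagonal -/

section LayerA

open Summit.MatrixMultiplication.MatrixMultiplication.Theorems.PerfectAmortisation
  (tensorRestrictsTo_matMulDirectSum_multiple_of_eq prod_cwFmtK_eq prod_cwFmtM_eq prod_cwFmtN_eq)  -- landed, imported

/-- **Layer A.** For level triples `Δ` of `cw_q^{⊗N}` coordinatewise in `{(0,1,1),(1,0,1),(1,1,0)}`, all with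
`m₁` positions of pattern `(1,1,0)`, `m₂` of `(0,1,1)`, `m₃` of `(1,0,1)`, forming a free diagonal,
`cw_q^{⊗N}` restricts to `⟨|Δ|⟩ ⊗ ⟨q^{m₁}, q^{m₂}, q^{m₃}⟩` (BCS 1997 Prop. 15.30 / proof of Thm. 15.41). -/
theorem lcwRectRestriction :
    ∀ (q m₁ m₂ m₃ N : ℕ)
      (Δ : Finset ((Fin N → Fin 3) × (Fin N → Fin 3) × (Fin N → Fin 3))),
      (∀ δ ∈ Δ, ∀ ρ, labelSeq δ ρ ∈ lcwSupport₃) →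
      (∀ δ ∈ Δ, letterCount (labelSeq δ) (1, 1, 0) = m₁ ∧ letterCount (labelSeq δ) (0, 1, 1) = m₂ ∧
        letterCount (labelSeq δ) (1, 0, 1) = m₃) →
      (∀ δ ∈ Δ, ∀ δ' ∈ Δ, ∀ δ'' ∈ Δ, (∀ ρ, (δ.1 ρ, δ'.2.1 ρ, δ''.2.2 ρ) ∈ lcwSupport₃) →
        δ = δ' ∧ δ' = δ'') →
      TensorRestrictsTo (kroneckerPow (cwTensor ℂ q) N)
        (kroneckerTensor (unitTensor ℂ Δ.card) (matMulTensor ℂ (q ^ m₁) (q ^ m₂) (q ^ m₃))) := by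
  intro q m₁ m₂ m₃ N Δ hS hcnt hfree
  classical
  set p := Δ.card with hp
  set d : Fin p → (Fin N → Fin 3) × (Fin N → Fin 3) × (Fin N → Fin 3) :=
    fun i => (Δ.equivFin.symm i).1 with hd_def
  have hdmem : ∀ i, d i ∈ Δ := fun i => (Δ.equivFin.symm i).2
  have hd : Function.Injective d := fun i i' h =>
    Δ.equivFin.symm.injective (Subtype.ext h)
  have hlev := lcwLevel_indexMaps q
  have hres := tensorRestrictsTo_kroneckerPow_matMulDirectSum_of_free (cwTensor ℂ q)
    lcwLevel lcwLevel lcwLevel lcwSupport₃ (fun _ _ _ h => lcwLevel_mem_support ℂ h)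
    (cwFmtK q) (cwFmtM q) (cwFmtN q) (lcwEI q) (lcwEJ q) (lcwEL q)
    (fun s hs u => (hlev s hs).1 u) (fun s hs v => (hlev s hs).2.1 v)
    (fun s hs w => (hlev s hs).2.2 w)
    (fun s hs u v w => cwTensor_component ℂ q s hs u v w)
    d (fun i ρ => hS _ (hdmem i) ρ)
    (fun i i' i'' h => by
      have h' := hfree _ (hdmem i) _ (hdmem i') _ (hdmem i'') h
      exact ⟨hd h'.1, hd h'.2⟩)
  have hK : ∀ i, ∏ ρ, cwFmtK q (labelSeq (d i) ρ) = q ^ m₁ := fun i => by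
    rw [prod_cwFmtK_eq q (labelSeq (d i)), (hcnt _ (hdmem i)).1]
  have hM : ∀ i, ∏ ρ, cwFmtM q (labelSeq (d i) ρ) = q ^ m₂ := fun i => by
    rw [prod_cwFmtM_eq q (labelSeq (d i)), (hcnt _ (hdmem i)).2.1]
  have hN : ∀ i, ∏ ρ, cwFmtN q (labelSeq (d i) ρ) = q ^ m₃ := fun i => by
    rw [prod_cwFmtN_eq q (labelSeq (d i)), (hcnt _ (hdmem i)).2.2]
  exact hres.trans (tensorRestrictsTo_matMulDirectSum_multiple_of_eq _ _ _ hK hM hN)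

end LayerA

end Summit.MatrixMultiplication.MatrixMultiplication.Theorems.LittleCwFarEdgeBound
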